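import Mathlib.NumberTheory.Padics.PadicNumbers
import Mathlib.NumberTheory.Padics.PadicNorm
import Mathlib.NumberTheory.Padics.PadicIntegers
import Mathlib.NumberTheory.ArithmeticFunction.Misc
import Mathlib.LinearAlgebra.Matrix.Determinant.Basic
import Mathlib.Topology.Algebra.InfiniteSum.Basic
import Mathlib.AlgebraicGeometry.EllipticCurve.Reduction
import Literature.NumberTheory.EllipticCurves.MordellWeil
import Literature.NumberTheory.EllipticCurves.GlobalMinimalModel
import Literature.NumberTheory.EllipticCurves.Tamagawa
import HarnessLib

-- provenance: harness21/H21/H21/Prelude/EllArithM/PAdicHeights.lean @ e9807c0 (interim HEAD d8f2665); M5 mechanical rewrite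
/-!
# `p`-adic heights, the `p`-adic regulator, Tate parameters and the `𝓛`-invariant

Trunk T-ELLARITH-M (group G16 EllArithM, outline item C20 `PAdicHeights`, tier L; notion
`p_adic_height_regulator`). This prelude file provides the vocabulary consumed by the `p`-adic
BSD statement file (`Statements/BSD/PAdicBSD.lean`, bsd.S20–S24):

* `Literature.NumberTheory.EllipticCurves.padicLogSeries`, `Literature.padicLog p x` — the Iwasawa `p`-adic logarithm `log_p : ℚ_p → ℚ_p`
  (`log_p p = 0`), a REAL definition: for `x = p^v · u`, `u ∈ ℤ_pˣ`,
  `log_p x := (p - 1)⁻¹ · L(u^{p-1})` with `L(y) = -∑_{n ≥ 1} (1 - y)^n / n` (convergent since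
  `u^{p-1} ≡ 1 (mod p)`);
* `Literature.tateE4 q`, `Literature.tateDelta q`, `Literature.tateJ q` — the `q`-expansions
  `E₄(q) = 1 + 240 ∑ σ₃(n) qⁿ`, `Δ(q) = q ∏ (1 - qⁿ)²⁴`, `j(q) = E₄(q)³ / Δ(q) = q⁻¹ + 744 + ⋯`
  in a normed field (Silverman, *Advanced Topics* (ATAEC) V.1, V.3);
* `WeierstrassCurve.HasSplitMultiplicativeReductionAtPrime W p` — companion of the accepted
  `HasGoodReductionAtPrime` / `HasMultiplicativeReductionAtPrime` (G06 `Tamagawa.lean`);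
* `WeierstrassCurve.PAdicHeightData W p` — hypothesis-structure: a symmetric bilinear pairing
  `E(ℚ) →+ E(ℚ) →+ ℚ_p` vanishing on torsion; `padicHeightPairingMatrix`, `padicRegulatorOf`,
  `padicRegulator` (Gram determinant on a Mordell–Weil basis, junk `0`);
* `WeierstrassCurve.TateParameterData W p` — hypothesis-structure: the Tate parameter
  `q ∈ pℤ_p ∖ {0}` of `E/ℚ_p` at a prime of split multiplicative reduction, pinned by
  `j(q) = j(E)`; `WeierstrassCurve.LInvariant D = log_p q / ord_p q`;
* theorems (proofs `sorry`, known in print): `TateParameterData.q_unique`,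
  `nonempty_tateParameterData_iff` (Tate), `TateParameterData.valuation_q_eq_padicValInt`
  (`ord_p q = ord_p Δ_min`), `LInvariant_ne_zero` (Barré-Sirieix–Diaz–Gramain–Philibert 1996);
* `WeierstrassCurve.SchneiderConjecture D : Prop` — non-degeneracy of the `p`-adic height
  (open; `def … : Prop` only).

## Mathlib search

Mathlib (pin v4.32.0) has `Padic`, `Padic.valuation : ℚ_[p] → ℤ`, `PadicInt`,
`ArithmeticFunction.sigma`, `tsum`/`tprod`, `Matrix.det`, `WeierstrassCurve.j`,
`WeierstrassCurve.minimal`, `WeierstrassCurve.HasSplitMultiplicativeReduction` — all used here. It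
has NO `p`-adic logarithm (searched `Padic.*log`, `logarithm` under `NumberTheory/Padics`; only the
Witt-vector/perfectoid `Perfection.teichmuller`), no Tate curve, no `q`-expansion of `j`, no
`p`-adic
height; these are defined here (the logarithm honestly, the heights as a hypothesis-structure).

## Design choices

* Group rule (outline G06 §0): `noncomputable section`, `open scoped Classical`, no
  `[DecidableEq K]`
  variable. Elliptic-curve declarations are deliberate dot-notation extensions of Mathlib's
  `namespace WeierstrassCurve`; generic ones (`padicLog`, `tateJ`, …) live in `namespace Literature`.
  No continuous cohomology occurs in this file, so no universe annotation is needed.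
* **Vacuity flag (outline §4.3).** `PAdicHeightData` is intended to be instantiated by the canonical
  cyclotomic `p`-adic height of Schneider (1982) = Mazur–Tate (1983) = Nekovář (1993) at a good
  ordinary prime `p`; its *normalisation is NOT axiomatised* (there is no honest way to do so
  without `p`-adic sigma functions / Coleman integration, absent from Mathlib). Hence the zero
  pairing is a `PAdicHeightData`, statements quantify over `D`, and a predicate
  `IsCanonicalPAdicHeight D` singling out the canonical height is left to a later item. The
  trivial `Nonempty (PAdicHeightData W p)` is deliberately not stated.
* **Tate parameter.** The outline's axioms `‖j q - 1‖ < 1 ∧ ord q = ord Δ_min` do *not* determine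
  `q` (they are stable under `q ↦ q (1 + p u)`), so instead the structure carries the exact identity
  `tateJ q = j(E)` (`j(E_q) = 1/q + 744 + 196884 q + ⋯`, ATAEC V.3.1(b)), which pins `q` uniquely
  (ATAEC V.5.1), together with the field `split : W.HasSplitMultiplicativeReductionAtPrime p`
  (for `|j|_p > 1` alone only gives *potentially* multiplicative reduction; `E ≅ E_q` over `ℚ_p`
  iff the reduction is split multiplicative, ATAEC V.5.3). `ord_p q = ord_p Δ_min` becomes the
  theorem `valuation_q_eq_padicValInt`. Since Mathlib has no `p`-adic logarithm, `Literature.NumberTheory.EllipticCurves.padicLog` is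
  defined here and the outline's `logq`/`logq_spec` fields are not needed.
* `padicRegulator D` follows the G06 `Regulator.lean` pattern (`…Matrix`, `…Of`, chosen basis,
  junk `0`); basis-independence is the theorem `padicRegulatorOf_eq_padicRegulator`.
* `SchneiderConjecture` takes the height datum `D` as a parameter (see the vacuity flag):
  Schneider's
  conjecture proper is `SchneiderConjecture D` for `D` the canonical height at good ordinary `p`.

## References

* [MazurTateTeitelbaum1986Invent] B. Mazur, J. Tate, J. Teitelbaum, *On `p`-adic analogues of the
  conjectures of Birch and Swinnerton-Dyer*, Invent. Math. 84 (1986) 1–48, §II.1 (Tate parameter,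
  `𝓛`-invariant), §II.4 (`p`-adic height, regulator) (MTT).
* [Schneider1982PadicHeightI] P. Schneider, *`p`-adic height pairings I*, Invent. Math. 69 (1982)
  401–409, §1; [Schneider1985] *II*, Invent. Math. 79 (1985).
* B. Mazur, J. Tate, *Canonical height pairings via biextensions*, in *Arithmetic and Geometry* I,
  Progr. Math. 35 (1983).
* J. Nekovář, *On `p`-adic height pairings*, Sém. Théorie des Nombres Paris 1990–91, Progr. Math.
  108 (1993).
* [BarreSirieixDiazGramainPhilibert1996Manin] K. Barré-Sirieix, G. Diaz, F. Gramain, G. Philibert,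
  *Une preuve de la conjecture de Mahler–Manin*, Invent. Math. 124 (1996) 1–9, Thm. 1 and Cor.
  (BDGP).
* [SilvermanATAEC1994] J. H. Silverman, *Advanced Topics in the Arithmetic of Elliptic Curves*
  (ATAEC), GTM 151, ch. V: Thm. V.3.1 (Tate curve), Lemma V.5.1 (`q ↦ j(q)` is a bijection from
  the punctured unit disc onto `‖j‖ > 1`), Thm. V.5.3 (Tate's theorem).
* [Iwasawa1972PadicL] K. Iwasawa, *Lectures on `p`-adic `L`-functions*, Ann. Math. Stud. 74
  (1972), §4.4 (`log_p`).
-/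

noncomputable section

open scoped Classical
open scoped ArithmeticFunction.sigma

/-! ### Generic `p`-adic analysis: the Iwasawa logarithm and Tate's `q`-expansions -/

namespace Literature.NumberTheory.EllipticCurves

section PadicLog

variable (p : ℕ) [Fact p.Prime]

/-- The logarithmic series `L(y) = -∑_{n ≥ 1} (1 - y)ⁿ / n` in `ℚ_p`, written as a `tsum` over
`n : ℕ` of `-(1 - y)^(n+1) / (n+1)`. It converges (to the `p`-adic logarithm of `y`) exactly on the
principal units `‖y - 1‖ < 1`; elsewhere `tsum` returns the junk value `0`
(Iwasawa 1972, §4.4; used only through `padicLog`). [cite: Iwasawa1972PadicL, §4.4] -/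
def padicLogSeries (y : ℚ_[p]) : ℚ_[p] :=
  ∑' n : ℕ, -((1 - y) ^ (n + 1)) / (n + 1 : ℚ_[p])

/-- The **Iwasawa `p`-adic logarithm** `log_p : ℚ_p → ℚ_p`, the unique group homomorphism
`ℚ_pˣ → ℚ_p` extending the logarithmic series on principal units with `log_p p = 0`
(Iwasawa 1972, §4.4; MTT 1986, §II.1). Definition: for `x ≠ 0` write `x = p^{ord_p x} · u` with
`u ∈ ℤ_pˣ`; then `u^{p-1}` is a principal unit and `log_p x := (p - 1)⁻¹ · L(u^{p-1})`
(`Literature.NumberTheory.EllipticCurves.padicLogSeries`). Junk value `log_p 0 = 0`. [cite: Iwasawa1972PadicL, §4.4] -/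
def padicLog (x : ℚ_[p]) : ℚ_[p] :=
  if x = 0 then 0
  else ((p : ℚ_[p]) - 1)⁻¹ *
    padicLogSeries p ((x * (p : ℚ_[p]) ^ (-x.valuation)) ^ (p - 1))

/-- `log_p 0 = 0` (junk value, by definition). [folklore] -/
@[simp]
theorem padicLog_zero : padicLog p 0 = 0 := by
  simp [padicLog]

/-- On principal units the Iwasawa logarithm is given by the logarithmic series:
`‖y - 1‖ < 1 → log_p y = -∑_{n ≥ 1} (1 - y)ⁿ / n` (Iwasawa 1972, §4.4, Lemma).
[cite: Iwasawa1972PadicL, §4.4, Lemma] -/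
def hasSum_padicLog : Prop :=
  ∀ {y : ℚ_[p]} (hy : ‖y - 1‖ < 1),
    HasSum (fun n : ℕ ↦ -((1 - y) ^ (n + 1)) / (n + 1 : ℚ_[p])) (padicLog p y)

/-- The Iwasawa normalisation `log_p p = 0` (Iwasawa 1972, §4.4). [cite: Iwasawa1972PadicL, §4.4] -/
def padicLog_natCast_self : Prop :=
  padicLog p (p : ℚ_[p]) = 0

/-- `log_p` is a homomorphism on `ℚ_pˣ`: `log_p (x y) = log_p x + log_p y` for `x, y ≠ 0`
(Iwasawa 1972, §4.4). [cite: Iwasawa1972PadicL, §4.4] -/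
def padicLog_mul : Prop :=
  ∀ {x y : ℚ_[p]} (hx : x ≠ 0) (hy : y ≠ 0),
    padicLog p (x * y) = padicLog p x + padicLog p y

/-- The kernel of the Iwasawa logarithm on `ℚ_pˣ` is `p^ℤ · μ(ℚ_p)`: for `x ≠ 0`,
`log_p x = 0 ↔ ∃ n : ℤ, ∃ k > 0, (x · p^{-n})^k = 1` (Iwasawa 1972, §4.4).
[cite: Iwasawa1972PadicL, §4.4] -/
def padicLog_eq_zero_iff : Prop :=
  ∀ {x : ℚ_[p]} (hx : x ≠ 0),
    padicLog p x = 0 ↔ ∃ (n : ℤ) (k : ℕ), 0 < k ∧ (x * (p : ℚ_[p]) ^ (-n)) ^ k = 1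

end PadicLog

section TateSeries

variable {K : Type*} [NormedField K]

/-- The `q`-expansion of the normalised Eisenstein series of weight `4`,
`E₄(q) = 1 + 240 ∑_{n ≥ 1} σ₃(n) qⁿ` (as a `tsum` over `n : ℕ` of the terms at `n + 1`), in a
normed field; convergent for `‖q‖ < 1` in a complete field, junk `tsum` value otherwise
(Silverman ATAEC V.1, Thm. V.3.1; `a₄(q), a₆(q)` are recovered from `E₄, E₆`). [folklore] -/
def tateE4 (q : K) : K :=
  1 + 240 * ∑' n : ℕ, ((σ 3 (n + 1) : ℕ) : K) * q ^ (n + 1)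

/-- The `q`-expansion of the discriminant, `Δ(q) = q ∏_{n ≥ 1} (1 - qⁿ)²⁴` (as a `tprod` over
`n : ℕ` of the factors at `n + 1`); convergent for `‖q‖ < 1` in a complete field, junk `tprod` value
otherwise. This is the discriminant of the Tate curve `E_q` (Silverman ATAEC Thm. V.3.1(b)).
[folklore] -/
def tateDelta (q : K) : K :=
  q * ∏' n : ℕ, (1 - q ^ (n + 1)) ^ 24

/-- The `j`-invariant of the Tate curve as a function of `q`:
`j(q) = E₄(q)³ / Δ(q) = q⁻¹ + 744 + 196884 q + ⋯` (Silverman ATAEC Thm. V.3.1(b)). Junk value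
`0` at `q = 0` (division by `Δ(0) = 0`). [folklore] -/
def tateJ (q : K) : K :=
  tateE4 q ^ 3 / tateDelta q

/-- `q ↦ j(q)` is injective on the punctured open unit disc of `ℚ_p`; more precisely, for every
`j₀ ∈ ℚ_p` with `‖j₀‖ > 1` there is a unique `q` with `0 < ‖q‖ < 1` and `j(q) = j₀`
(Silverman ATAEC Lemma V.5.1). [cite: SilvermanATAEC1994, Lemma V.5.1] -/
def existsUnique_tateJ_eq : Prop :=
  ∀ (p : ℕ) [Fact p.Prime] {j₀ : ℚ_[p]} (hj : 1 < ‖j₀‖),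
    ∃! q : ℚ_[p], q ≠ 0 ∧ ‖q‖ < 1 ∧ tateJ q = j₀

/-- For `0 < ‖q‖ < 1` in `ℚ_p` one has `‖j(q)‖ = ‖q‖⁻¹ > 1`, i.e. `ord_p j(q) = - ord_p q`
(Silverman ATAEC V.3.1(b) and Lemma V.5.1). [cite: SilvermanATAEC1994, Thm. V.3.1(b)] -/
def valuation_tateJ : Prop :=
  ∀ (p : ℕ) [Fact p.Prime] {q : ℚ_[p]} (hq : q ≠ 0) (hq' : ‖q‖ < 1),
    (tateJ q).valuation = -q.valuation

end TateSeries

end Literature.NumberTheory.EllipticCurves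

/-! ### Elliptic-curve declarations (dot-notation extensions of `WeierstrassCurve`) -/

namespace WeierstrassCurve

open Literature.NumberTheory.EllipticCurves

variable (W : WeierstrassCurve ℚ) (p : ℕ) [Fact p.Prime]

/-- `W / ℚ` *has split multiplicative reduction at the prime* `p`: the `ℤ_p`-minimal model of
`W / ℚ_p` has split multiplicative reduction (Mathlib
`WeierstrassCurve.HasSplitMultiplicativeReduction`
for `(W.baseChange ℚ_[p]).minimal ℤ_[p]`); companion of `HasGoodReductionAtPrime` and
`HasMultiplicativeReductionAtPrime` of `Literature.Prelude.TranscendEllArithS.Tamagawa`, same conventions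
(Silverman, *AEC* VII.5; ATAEC V.5.3). [folklore] -/
def HasSplitMultiplicativeReductionAtPrime : Prop :=
  ((W.baseChange ℚ_[p]).minimal ℤ_[p]).HasSplitMultiplicativeReduction ℤ_[p]

/-- Split multiplicative reduction at `p` is multiplicative reduction at `p` (by definition of
Mathlib's `HasSplitMultiplicativeReduction`, which extends `HasMultiplicativeReduction`). [folklore]
-/
theorem HasSplitMultiplicativeReductionAtPrime.hasMultiplicativeReductionAtPrime
    {W : WeierstrassCurve ℚ} {p : ℕ} [Fact p.Prime]
    (h : W.HasSplitMultiplicativeReductionAtPrime p) : W.HasMultiplicativeReductionAtPrime p :=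
  h.toHasMultiplicativeReduction

/-! ### `p`-adic heights and the `p`-adic regulator -/

/-- **Hypothesis-structure** for a `p`-adic height pairing on `E(ℚ)`: a symmetric bilinear pairing
`⟨·,·⟩_p : E(ℚ) × E(ℚ) → ℚ_p` vanishing on torsion. It is *intended* to be instantiated by the
canonical cyclotomic `p`-adic height at a good ordinary prime `p` (Schneider 1982 = Mazur–Tate 1983
= Nekovář 1993; MTT 1986, §II.4), but **the normalisation is not axiomatised** (no `p`-adic sigma
function / Coleman integration in Mathlib), so e.g. the zero pairing is an instance: statements
must quantify over `D`, and this vacuity risk is flagged (outline §4.3). A predicate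
`IsCanonicalPAdicHeight D` is left to a later item. [cite: Schneider1982PadicHeightI, §1] -/
structure PAdicHeightData (W : WeierstrassCurve ℚ) (p : ℕ) [Fact p.Prime] where
  /-- The bilinear pairing `E(ℚ) →+ E(ℚ) →+ ℚ_p`. -/
  pairing : W.toAffine.Point →+ W.toAffine.Point →+ ℚ_[p]
  /-- Symmetry `⟨P, Q⟩ = ⟨Q, P⟩`. -/
  symm : ∀ P Q, pairing P Q = pairing Q P
  /-- The pairing vanishes on torsion points (in the first variable). -/
  map_torsion : ∀ P Q, IsOfFinAddOrder P → pairing P Q = 0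

namespace PAdicHeightData

variable {W p}
variable (D : PAdicHeightData W p)

/-- The pairing vanishes on torsion points in the second variable (from `symm`, `map_torsion`).
[folklore] -/
theorem map_torsion_right (P Q : W.toAffine.Point) (hQ : IsOfFinAddOrder Q) :
    D.pairing P Q = 0 := by
  rw [D.symm]
  exact D.map_torsion Q P hQ

/-- The `p`-adic height pairing matrix `(⟨Pᵢ, Pⱼ⟩_p)ᵢⱼ` of a family of points
`P : ι → E(ℚ)` (MTT 1986, §II.4; same shape as G06 `heightPairingMatrix`).
[cite: MazurTateTeitelbaum1986Invent, §II.4] -/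
def pairingMatrix {ι : Type*} (P : ι → W.toAffine.Point) : Matrix ι ι ℚ_[p] :=
  Matrix.of fun i j ↦ D.pairing (P i) (P j)

/-- The pairing matrix is symmetric. [folklore] -/
theorem pairingMatrix_transpose {ι : Type*} (P : ι → W.toAffine.Point) :
    (D.pairingMatrix P).transpose = D.pairingMatrix P := by
  ext i j
  exact D.symm (P j) (P i)

end PAdicHeightData

variable {W p} in
/-- The `p`-adic regulator `det (⟨Pᵢ, Pⱼ⟩_p)ᵢⱼ` of a finite family of points with respect to the
height datum `D` (`= 1` for the empty family; MTT 1986, §II.4; same shape as G06 `regulatorOf`).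
[cite: MazurTateTeitelbaum1986Invent, §II.4] -/
def padicRegulatorOf (D : PAdicHeightData W p) {ι : Type*} [Fintype ι]
    (P : ι → W.toAffine.Point) : ℚ_[p] :=
  (D.pairingMatrix P).det

variable {W p} in
/-- The **`p`-adic regulator** `Reg_p(E, D) ∈ ℚ_p` of the height datum `D`: the Gram determinant
`det (⟨Pᵢ, Pⱼ⟩_p)` on a chosen Mordell–Weil basis `P₁, …, P_r` of `E(ℚ)/tors`
(`WeierstrassCurve.IsMordellWeilBasis`; MTT 1986, §II.4). Junk value `0` if no Mordell–Weil basis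
exists (never the case, `WeierstrassCurve.exists_isMordellWeilBasis`). Independent of the basis:
`padicRegulatorOf_eq_padicRegulator`. [cite: MazurTateTeitelbaum1986Invent, §II.4] -/
def padicRegulator (D : PAdicHeightData W p) : ℚ_[p] :=
  if h : ∃ (n : ℕ) (P : Fin n → W.toAffine.Point), IsMordellWeilBasis P then
    padicRegulatorOf D h.choose_spec.choose
  else 0

variable {W p} in
/-- The `p`-adic regulator does not depend on the Mordell–Weil basis: two bases of `E(ℚ)/tors`
differ by `γ ∈ GL_r(ℤ)` and torsion, and `det γ = ±1` (bilinearity + `map_torsion`;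
MTT 1986, §II.4). [cite: MazurTateTeitelbaum1986Invent, §II.4] -/
def padicRegulatorOf_eq_padicRegulator : Prop :=
  ∀ (D : PAdicHeightData W p) {ι : Type*} [Fintype ι] {P : ι → W.toAffine.Point} (hP : IsMordellWeilBasis P),
    padicRegulatorOf D P = padicRegulator D

variable {W p} in
/-- **Schneider's conjecture** (non-degeneracy of the `p`-adic height; Schneider 1982, §1;
MTT 1986, §II.4–II.5) *for the height datum* `D`: the `p`-adic regulator `Reg_p(E, D)` is nonzero.
Schneider's conjecture proper is this statement for `D` the canonical cyclotomic `p`-adic height at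
a prime `p` of good ordinary reduction; since that normalisation is not axiomatised in
`PAdicHeightData` (see its docstring), the datum is a parameter. Open; stated as a `Prop` only.
[cite: Schneider1982PadicHeightI, §1] -/
def SchneiderConjecture (D : PAdicHeightData W p) : Prop :=
  padicRegulator D ≠ 0

/-! ### Tate parameters and the `𝓛`-invariant -/

/-- **Hypothesis-structure** for the Tate parameter of `E/ℚ_p` at a prime `p` of split
multiplicative reduction: the unique `q ∈ ℚ_pˣ` with `‖q‖ < 1` and `E ≅ E_q = ℚ_pˣ/q^ℤ` over
`ℚ_p` (Tate; Silverman ATAEC Thm. V.3.1, V.5.3; MTT 1986, §II.1). The datum is pinned by the exact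
identity `j(q) = j(E)` (`Literature.NumberTheory.EllipticCurves.tateJ`, ATAEC V.3.1(b) and Lemma V.5.1: `q ↦ j(q)` is a bijection from
the punctured unit disc onto `‖j‖ > 1`) — see `TateParameterData.q_unique` — together with the
hypothesis `split` (for `‖j‖_p > 1` alone `E` is only a quadratic twist of `E_q`, ATAEC V.5.3).
The relation `ord_p q = ord_p Δ_min` is the theorem `valuation_q_eq_padicValInt`.
[cite: MazurTateTeitelbaum1986Invent, §II.1] -/
structure TateParameterData (W : WeierstrassCurve ℚ) [W.IsElliptic] (p : ℕ) [Fact p.Prime] where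
  /-- The Tate parameter `q ∈ ℚ_p`. -/
  q : ℚ_[p]
  /-- `q ≠ 0`. -/
  q_ne_zero : q ≠ 0
  /-- `‖q‖_p < 1`, i.e. `q ∈ p ℤ_p`. -/
  norm_q_lt_one : ‖q‖ < 1
  /-- `j(E_q) = j(E)`: `E₄(q)³ / Δ(q) = j(W)` in `ℚ_p`. -/
  tateJ_eq : tateJ q = (W.j : ℚ_[p])
  /-- `E` has split multiplicative reduction at `p`. -/
  split : W.HasSplitMultiplicativeReductionAtPrime p

namespace TateParameterData

variable {W p}
variable [W.IsElliptic] (D : TateParameterData W p)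

/-- The Tate parameter has positive valuation, `ord_p q > 0` (from `‖q‖ < 1`, `q ≠ 0` and
`‖q‖ = p^{-ord_p q}`, Mathlib `Padic.norm_eq_zpow_neg_valuation`). [folklore] -/
theorem valuation_q_pos : 0 < D.q.valuation := by
  have h := Padic.norm_eq_zpow_neg_valuation D.q_ne_zero
  have hlt := D.norm_q_lt_one
  rw [h] at hlt
  have hp : (1 : ℝ) ≤ p := by exact_mod_cast (Fact.out : p.Prime).one_lt.le
  by_contra hle
  have : (1 : ℝ) ≤ (p : ℝ) ^ (-D.q.valuation) := one_le_zpow₀ hp (by omega)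
  exact absurd hlt (not_lt.mpr this)

/-- **Uniqueness of the Tate parameter**: two Tate parameter data for `E` at `p` have the same `q`
(`q ↦ j(q)` is injective on the punctured unit disc; Silverman ATAEC Lemma V.5.1,
`Literature.NumberTheory.EllipticCurves.existsUnique_tateJ_eq`). [cite: SilvermanATAEC1994, Lemma V.5.1] -/
def q_unique : Prop :=
  ∀ (D D' : TateParameterData W p),
    D.q = D'.q

/-- `ord_p q = ord_p Δ` for the discriminant `Δ` of a `ℤ_p`-minimal model of `E/ℚ_p`
(`Δ(E_q) = Δ(q) = q ∏ (1 - qⁿ)²⁴` has valuation `ord_p q`, and the Tate equation is minimal;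
Silverman ATAEC V.3.1(b), remark V.3.1.2; MTT 1986, §II.1).
[cite: MazurTateTeitelbaum1986Invent, §II.1] -/
def valuation_q_eq : Prop :=
  ∀ (D : TateParameterData W p),
    D.q.valuation = Padic.valuation ((W.baseChange ℚ_[p]).minimal ℤ_[p]).Δ

/-- `ord_p q = ord_p Δ_min(E)` for the global minimal discriminant of `E/ℚ`
(`WeierstrassCurve.minimalDiscriminantInt`; a global minimal model is minimal at `p`;
Silverman ATAEC V.3.1(b), AEC VIII.8; MTT 1986, §II.1). [cite: MazurTateTeitelbaum1986Invent, §II.1]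
-/
def valuation_q_eq_padicValInt : Prop :=
  ∀ [W.IsGloballyMinimal] (D : TateParameterData W p),
    D.q.valuation = padicValInt p W.minimalDiscriminantInt

/-- `ord_p j(E) = - ord_p q < 0` (Silverman ATAEC V.3.1(b); `Literature.NumberTheory.EllipticCurves.valuation_tateJ`). [folklore] -/
def valuation_j : Prop :=
  ∀ (D : TateParameterData W p),
    Padic.valuation (W.j : ℚ_[p]) = -D.q.valuation

/- interim proof relied on results that are now named facts (D-0014); demoted to a fact by the M5
import, proof preserved:
:= by
  rw [← D.tateJ_eq]
  exact valuation_tateJ p D.q_ne_zero D.norm_q_lt_one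
-/

/-- `valuation_j` holds given the named fact `Literature.NumberTheory.EllipticCurves.valuation_tateJ` (the preserved interim proof,
with the fact threaded as hypothesis `h`). [folklore] -/
theorem valuation_j_holds (h : Literature.NumberTheory.EllipticCurves.valuation_tateJ) : valuation_j (W := W) (p := p) := by
  intro D
  rw [← D.tateJ_eq]
  exact h p D.q_ne_zero D.norm_q_lt_one

end TateParameterData

/-- **Tate's theorem** (existence): `E/ℚ` admits a Tate parameter at `p` if and only if `E` has
split
multiplicative reduction at `p` (Silverman ATAEC Thm. V.5.3 with Lemma V.5.1: split multiplicative
reduction gives `‖j‖_p > 1`, whence a unique `q` with `j(q) = j`; the converse is the field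
`split`). [cite: SilvermanATAEC1994, Thm. V.5.3] -/
def nonempty_tateParameterData_iff : Prop :=
  ∀ [W.IsElliptic],
    Nonempty (TateParameterData W p) ↔ W.HasSplitMultiplicativeReductionAtPrime p

variable {W p} in
/-- The **`𝓛`-invariant** of Mazur–Tate–Teitelbaum, `𝓛_p(E) = log_p q_E / ord_p q_E ∈ ℚ_p`, for
`E/ℚ` with split multiplicative reduction at `p` and Tate parameter `q_E = D.q` (MTT 1986, §II.1;
`Literature.NumberTheory.EllipticCurves.padicLog` is the Iwasawa logarithm). Well defined by `TateParameterData.q_unique`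
(`LInvariant_eq`); the denominator is nonzero by `TateParameterData.valuation_q_pos`.
[cite: MazurTateTeitelbaum1986Invent, §II.1] -/
def LInvariant [W.IsElliptic] (D : TateParameterData W p) : ℚ_[p] :=
  padicLog p D.q / (D.q.valuation : ℚ_[p])

variable {W p} in
/-- The `𝓛`-invariant does not depend on the chosen Tate parameter datum
(`TateParameterData.q_unique`). [folklore] -/
def LInvariant_eq : Prop :=
  ∀ [W.IsElliptic] (D D' : TateParameterData W p),
    LInvariant D = LInvariant D'

/- interim proof relied on results that are now named facts (D-0014); demoted to a fact by the M5
import, proof preserved: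
:= by
  rw [LInvariant, LInvariant, TateParameterData.q_unique D D']
-/

variable {W p} in
/-- `LInvariant_eq` holds given the named fact `TateParameterData.q_unique` (the preserved interim
proof, with the fact threaded as hypothesis `h`). [folklore] -/
theorem LInvariant_eq_holds (h : ∀ [W.IsElliptic], TateParameterData.q_unique (W := W) (p := p)) :
    LInvariant_eq (W := W) (p := p) := by
  intro _ D D'
  rw [LInvariant, LInvariant, h D D']

variable {W p} in
/-- **Non-vanishing of the `𝓛`-invariant** (Barré-Sirieix–Diaz–Gramain–Philibert 1996, Cor. of
Thm. 1 = the Mahler–Manin conjecture: for algebraic `j(E)` with `‖j‖_p > 1` the Tate parameter `q_E`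
is transcendental, hence `q_E ∉ p^ℤ · μ` and `log_p q_E ≠ 0`; MTT 1986, §II.1 conjectured it).
[cite: BarreSirieixDiazGramainPhilibert1996Manin, Thm. 1, Cor.] -/
def LInvariant_ne_zero : Prop :=
  ∀ [W.IsElliptic] (D : TateParameterData W p),
    LInvariant D ≠ 0

end WeierstrassCurve

end
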